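import Summits.QuantumFields.YangMills.Theorems.BalabanUVNodesN19UniformMomentPriceTwoSided

/-!
# YM-DAG node N19 (= NE7 proper) — THE DIMENSION DEPENDENCE OF THE JOINT-LAW PRICE, UPPER HALF: general ℓ¹-Lipschitz functionals
# `(76K|ι|² + 12G|ι|)∕(1 + log r⁻¹)`, additive functionals `48|ι|(K+G)∕(1 + log r⁻¹)` (closed forms on the Jackson road)

Cell `pub-ymgap`, HUMAN RULING D-0062 (Track A) ∕ D-0149 (work-bound push), R141 (C) wider-strategy seat `pub-ymgap-dag-n19-e` (strategy s3 =
ALTERNATIVE CURRENCY), generation g21, module 2 (lineage module 65; the LOWER half — the product binomial witness and the two-sided statement — is the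
sibling module 66 `…N19JointLawPriceDimensionWitness`, split under the 400-line rule).  Route `Summits/QuantumFields/YangMills/Theses/BalabanUVNodes.lean` rev 25,
cluster item K3⁷ «SpineGivenEndpointR13SepCoPH» (stmt-QuantumFields-20544); filed `--supports` that item `--as helper` (it proves no registered
stub).  COUNT-NEUTRAL: [folklore] approximation theory ∕ probability over Mathlib + the lineage BY NAME — module 61 `…N19DiscreteJacksonPricing`
(`abs_integral_sub_integral_le_of_mixedMoments_jackson`), module 63 `…N19UniformMomentPriceTwoSided` (`law_price_le_of_uniformMoments`,
`log_nine_le_five_halves`), p568465 `…N19JointLawBernstein` (`integrable_of_continuous_of_cube`); no scheme object, no Theses import; NOT a discharge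
claim.

THE QUESTION.  Module 61 ∕ 62 price a finite family `ι` of strings whose mixed moments are `r`-close UNIFORMLY IN THE DEGREE (at the scheme:
`r = R_K` under uniform `Target`, p570436) at `|∫f dP − ∫f dQ| ≤ 2πK|ι|∕m + G·(m·9^m)^{|ι|}·r` for every `m ≥ 1` (`f` `K`-Lipschitz for `Σ_i|u_i − v_i|`,
`G`-bounded on the cube).  Module 63 settled `|ι| = 1`: `Θ(1∕(1 + log r⁻¹))` two-sided.  HOW DOES THE PRICE GROW WITH THE NUMBER OF STRINGS?

THE ANSWERS (`L = log r⁻¹`, `0 < r ≤ 1`, `d = |ι| ≥ 1`).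
§1 GENERAL ℓ¹-LIPSCHITZ, CLOSED FORM ★ `law_price_le_of_uniformMixedMoments`: `|∫f dP − ∫f dQ| ≤ (76·K·d² + 12·G·d)∕(1 + L)` — module 61 at
`m = ⌊L∕(5d)⌋` when `L ≥ 5d` (`m ≥ L∕(10d)`, `(9^m)^d ≤ e^{L∕2}` by `log 9 ≤ 5∕2`, `m^d ≤ (L∕5d)^d ≤ e^{L∕5}` by `y ≤ e^y`, so `(m9^m)^d·r ≤ e^{−3L∕10}
≤ (10∕3)∕(1+L)`; `24π ≤ 76`), the trivial `2G ≤ 12Gd∕(1+L)` when `L < 5d`.  QUADRATIC in `d` through the Lipschitz constant: the tensor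
quasi-interpolant has `ℓ¹` mass `(m·9^m)^d`, which forces `m ≍ L∕d`.
§2 ADDITIVE FUNCTIONALS ★ `law_price_additive_le_of_uniformMixedMoments`: for `f(x) = Σ_i g_i(x_i)` (sums of ONE-string observables; `g_i`
`K_i`-Lipschitz, `G_i`-bounded on `[−1,1]`) the marginal laws `P∘x_i⁻¹` have `r`-close moments (mixed exponents `n·e_i`), so module 63 per coordinate
gives `≤ 48·Σ_i(K_i + G_i)∕(1 + L)` (`law_price_additive_le_card`: `≤ 48·d·(K+G)∕(1+L)`) — LINEAR in `d`.
THE LOWER HALF (sibling module 66): the product binomial witness `μ_n^{⊗ι}, ν_n^{⊗ι}` has ALL mixed moments `2^{−n}`-close (no `d` in `r`) and pays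
the additive `1`-ℓ¹-Lipschitz `Σ_i (1 − cos 2πnx_i)∕(2πn)` exactly `d∕(πn)`; so the ADDITIVE class is `Θ(d∕(1 + log r⁻¹))` TWO-SIDED and the general
ℓ¹-Lipschitz class lies between `d` and `d²` (honest gap, not closed).  At the scheme (module 62 at `r = R_K`): a family of `d` strings converges
jointly at `≲ d²∕log R_K⁻¹` on ℓ¹-Lipschitz functionals and at `≲ d∕log R_K⁻¹` on additive ones.

HONEST FRAMING (binding).  Elementary and [folklore] (Jackson ∕ Favard duality; marginals); NO consumer in the DAG today
(an optimality statement about the seat's own currency); nothing of Bałaban's instantiated; NE7 NOT PRINTED, NOT proved; N19 NOT discharged;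
count-neutral.  One finite `T⁴` programme at fixed `ε`; nothing continuum ∕ `ℝ⁴` ∕ OS ∕ mass-gap ∕ Clay.  0 `def` ∕ 0 `sorry`.
-/

noncomputable section

open Real Finset MeasureTheory ProbabilityTheory

namespace Summit.QuantumFields.YangMills.Theorems.BalabanUVNodesN19JointLawPriceDimension

open Summit.QuantumFields.YangMills.Theorems.BalabanUVNodesN19DiscreteJacksonPricing (abs_integral_sub_integral_le_of_mixedMoments_jackson)
open Summit.QuantumFields.YangMills.Theorems.BalabanUVNodesN19UniformMomentPriceTwoSided (law_price_le_of_uniformMoments log_nine_le_five_halves)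
open Summit.QuantumFields.YangMills.Theorems.BalabanUVNodesN19JointLawBernstein (integrable_of_continuous_of_cube)

variable {ι : Type*} [Fintype ι]

/-! ## §1 General ℓ¹-Lipschitz functionals: the closed form `(76Kd² + 12Gd)∕(1 + log r⁻¹)` [folklore] -/

omit [Fintype ι] in
/-- A law carried by the cube integrates a `G`-bounded function within `G`. [bookkeeping] -/
theorem abs_integral_le_of_cube {P : Measure (ι → ℝ)} [IsProbabilityMeasure P]
    (hP : P (Set.pi Set.univ (fun _ : ι => Set.Icc (-1 : ℝ) 1))ᶜ = 0) {f : (ι → ℝ) → ℝ} {G : ℝ}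
    (hG : ∀ u : ι → ℝ, (∀ i, u i ∈ Set.Icc (-1 : ℝ) 1) → |f u| ≤ G) : |∫ x, f x ∂P| ≤ G := by
  have hae : ∀ᵐ x ∂P, x ∈ Set.pi Set.univ (fun _ : ι => Set.Icc (-1 : ℝ) 1) := mem_ae_iff.2 hP
  have hbound : ∀ᵐ x ∂P, ‖f x‖ ≤ G := hae.mono fun x hx => by
    rw [Real.norm_eq_abs]
    exact hG x fun i => Set.mem_univ_pi.1 hx i
  have h := norm_integral_le_of_norm_le_const hbound
  rwa [probReal_univ, mul_one, Real.norm_eq_abs] at h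

/-- ★ **THE CLOSED FORM FOR ℓ¹-LIPSCHITZ FUNCTIONALS: `(76·K·d² + 12·G·d)∕(1 + log r⁻¹)`.**  Two probability laws `P, Q` on `[−1,1]^ι` (`ι` finite,
nonempty, `d = |ι|`) whose mixed moments satisfy `|∫∏x_i^{j_i} dP − ∫∏x_i^{j_i} dQ| ≤ r` for EVERY exponent vector `j` (`0 < r ≤ 1`), and a continuous
`f` with `|f u − f v| ≤ K·Σ_i|u_i − v_i|`, `|f| ≤ G` on the cube: `|∫f dP − ∫f dQ| ≤ (76Kd² + 12Gd)∕(1 + log r⁻¹)` (module 61 at `m = ⌊log r⁻¹∕(5d)⌋` when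
`log r⁻¹ ≥ 5d`, the trivial bound `2G` otherwise).  Quadratic in `d` through `K`. [folklore] -/
theorem law_price_le_of_uniformMixedMoments [Nonempty ι] {P Q : Measure (ι → ℝ)} [IsProbabilityMeasure P] [IsProbabilityMeasure Q]
    (hP : P (Set.pi Set.univ (fun _ : ι => Set.Icc (-1 : ℝ) 1))ᶜ = 0) (hQ : Q (Set.pi Set.univ (fun _ : ι => Set.Icc (-1 : ℝ) 1))ᶜ = 0)
    {r : ℝ} (hr0 : 0 < r) (hr1 : r ≤ 1)
    (hmom : ∀ j : ι → ℕ, |∫ x, ∏ i, x i ^ j i ∂P - ∫ x, ∏ i, x i ^ j i ∂Q| ≤ r)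
    {f : (ι → ℝ) → ℝ} (hf : Continuous f) {K G : ℝ} (hK0 : 0 ≤ K)
    (hK : ∀ u v : ι → ℝ, (∀ i, u i ∈ Set.Icc (-1 : ℝ) 1) → (∀ i, v i ∈ Set.Icc (-1 : ℝ) 1) → |f u - f v| ≤ K * ∑ i, |u i - v i|)
    (hG : ∀ u : ι → ℝ, (∀ i, u i ∈ Set.Icc (-1 : ℝ) 1) → |f u| ≤ G) :
    |∫ x, f x ∂P - ∫ x, f x ∂Q| ≤
      (76 * K * (Fintype.card ι : ℝ) ^ 2 + 12 * G * Fintype.card ι) / (1 + Real.log r⁻¹) := by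
  classical
  have hG0 : 0 ≤ G := (abs_nonneg _).trans (hG (fun _ => 0) fun _ => ⟨by norm_num, by norm_num⟩)
  set d : ℕ := Fintype.card ι with hddef
  have hd : 1 ≤ d := Fintype.card_pos
  have hdr : (1 : ℝ) ≤ d := by exact_mod_cast hd
  set L : ℝ := Real.log r⁻¹ with hLdef
  have hL0 : 0 ≤ L := Real.log_nonneg ((one_le_inv₀ hr0).2 hr1)
  have hrL : r = Real.exp (-L) := by rw [Real.exp_neg, hLdef, Real.exp_log (inv_pos.2 hr0), inv_inv]
  -- the trivial bound
  have htriv : |∫ x, f x ∂P - ∫ x, f x ∂Q| ≤ 2 * G := by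
    calc |∫ x, f x ∂P - ∫ x, f x ∂Q| ≤ |∫ x, f x ∂P| + |∫ x, f x ∂Q| := abs_sub _ _
      _ ≤ G + G := add_le_add (abs_integral_le_of_cube hP hG) (abs_integral_le_of_cube hQ hG)
      _ = 2 * G := by ring
  rcases lt_or_ge L (5 * d) with hLd | hLd
  · -- `L < 5d`: `2G ≤ 12Gd∕(1+L)`
    calc |∫ x, f x ∂P - ∫ x, f x ∂Q| ≤ 2 * G := htriv
      _ ≤ 12 * G * d / (1 + L) := by
          rw [le_div_iff₀ (by positivity)]
          have h6 : 1 + L ≤ 6 * d := by linarith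
          nlinarith [mul_le_mul_of_nonneg_left h6 (by positivity : (0 : ℝ) ≤ 2 * G)]
      _ ≤ (76 * K * (d : ℝ) ^ 2 + 12 * G * d) / (1 + L) := by
          refine div_le_div_of_nonneg_right ?_ (by positivity)
          nlinarith [mul_nonneg hK0 (sq_nonneg (d : ℝ))]
  · -- `5d ≤ L`: module 61 at `m = ⌊L∕(5d)⌋ ≥ 1`
    set m : ℕ := ⌊L / (5 * d)⌋₊ with hmdef
    have hy1 : (1 : ℝ) ≤ L / (5 * d) := by rw [le_div_iff₀ (by positivity)]; linarith
    have hm1 : 1 ≤ m := Nat.le_floor (by exact_mod_cast hy1)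
    have hm : 0 < m := hm1
    have hm1r : (1 : ℝ) ≤ m := by exact_mod_cast hm1
    have hmy : (m : ℝ) ≤ L / (5 * d) := Nat.floor_le (by positivity)
    have hmy2 : L / (5 * d) ≤ 2 * m := by
      have := Nat.lt_floor_add_one (L / (5 * d))
      rw [← hmdef] at this
      linarith
    have hJ := abs_integral_sub_integral_le_of_mixedMoments_jackson hP hQ hm hr0.le (fun j => hmom fun i => (j i : ℕ)) hf hK0 hK hG
    rw [← hddef] at hJ
    -- the `K`-term: `1 + L ≤ 12dm`, `24π ≤ 76`
    have hLm : L ≤ 10 * d * m := by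
      have h := (div_le_iff₀ (by positivity : (0 : ℝ) < 5 * d)).1 hmy2
      linarith
    have h1L : 1 + L ≤ 12 * d * m := by linarith
    have hA : 2 * K * (π * d / m) ≤ 76 * K * (d : ℝ) ^ 2 / (1 + L) := by
      have hmpos : (0 : ℝ) < m := by positivity
      rw [mul_div_assoc', div_le_div_iff₀ hmpos (by positivity)]
      have hπ : π < 3.15 := Real.pi_lt_d2
      calc 2 * K * (π * d) * (1 + L) ≤ 2 * K * (π * d) * (12 * d * m) := mul_le_mul_of_nonneg_left h1L (by positivity)
        _ = (24 * π) * (K * d ^ 2 * m) := by ring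
        _ ≤ 76 * (K * d ^ 2 * m) := mul_le_mul_of_nonneg_right (by linarith) (by positivity)
        _ = 76 * K * (d : ℝ) ^ 2 * m := by ring
    -- the `G`-term: `(m·9^m)^d·r ≤ e^{L∕5}·e^{L∕2}·e^{−L} ≤ (10∕3)∕(1+L)`
    have h9 : ((9 : ℝ) ^ m) ^ d ≤ Real.exp (L / 2) := by
      rw [← pow_mul, ← Real.exp_log (by norm_num : (0 : ℝ) < 9), ← Real.exp_nat_mul]
      refine Real.exp_le_exp.2 ?_
      push_cast
      calc (m : ℝ) * d * Real.log 9 ≤ L / (5 * d) * d * (5 / 2) :=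
            mul_le_mul (mul_le_mul_of_nonneg_right hmy (by positivity)) log_nine_le_five_halves
              (Real.log_nonneg (by norm_num)) (by positivity)
        _ = L / 2 := by field_simp
    have hmd : (m : ℝ) ^ d ≤ Real.exp (L / 5) := by
      -- `y^d ≤ e^{d·y}` for `y = L∕(5d) ≥ 0` (`y ≤ 1 + y ≤ e^y`; the tree's `TaoCascade.ZeroScale.pow_le_exp_mul`, inlined)
      have hy : (0 : ℝ) ≤ L / (5 * d) := by positivity
      have h1 : L / (5 * d) ≤ Real.exp (L / (5 * d)) := by have := Real.add_one_le_exp (L / (5 * d)); linarith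
      calc (m : ℝ) ^ d ≤ (L / (5 * d)) ^ d := pow_le_pow_left₀ (by positivity) hmy d
        _ ≤ (Real.exp (L / (5 * d))) ^ d := pow_le_pow_left₀ hy h1 d
        _ = Real.exp (d * (L / (5 * d))) := by rw [← Real.exp_nat_mul]
        _ = Real.exp (L / 5) := by congr 1; field_simp
    have hprod : ((m : ℝ) * 9 ^ m) ^ d * r ≤ Real.exp (-(3 * L / 10)) := by
      rw [mul_pow, hrL]
      calc (m : ℝ) ^ d * ((9 : ℝ) ^ m) ^ d * Real.exp (-L) ≤ Real.exp (L / 5) * Real.exp (L / 2) * Real.exp (-L) :=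
            mul_le_mul_of_nonneg_right (mul_le_mul hmd h9 (by positivity) (by positivity)) (by positivity)
        _ = Real.exp (-(3 * L / 10)) := by rw [← Real.exp_add, ← Real.exp_add]; congr 1; ring
    have hexp : Real.exp (-(3 * L / 10)) ≤ (10 / 3) / (1 + L) := by
      have hE := Real.add_one_le_exp (3 * L / 10)
      have hE0 : 0 < Real.exp (3 * L / 10) := Real.exp_pos _
      rw [Real.exp_neg, inv_eq_one_div, div_le_div_iff₀ hE0 (by positivity)]
      nlinarith
    have hB : G * ((m : ℝ) * 9 ^ m) ^ d * r ≤ 4 * G / (1 + L) := by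
      calc G * ((m : ℝ) * 9 ^ m) ^ d * r = G * (((m : ℝ) * 9 ^ m) ^ d * r) := by ring
        _ ≤ G * ((10 / 3) / (1 + L)) := mul_le_mul_of_nonneg_left (hprod.trans hexp) hG0
        _ ≤ 4 * G / (1 + L) := by
            rw [mul_div_assoc', div_le_div_iff_of_pos_right (by positivity)]
            nlinarith
    calc |∫ x, f x ∂P - ∫ x, f x ∂Q| ≤ 2 * K * (π * d / m) + G * ((m : ℝ) * 9 ^ m) ^ d * r := hJ
      _ ≤ 76 * K * (d : ℝ) ^ 2 / (1 + L) + 4 * G / (1 + L) := add_le_add hA hB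
      _ ≤ (76 * K * (d : ℝ) ^ 2 + 12 * G * d) / (1 + L) := by
          rw [← add_div, div_le_div_iff_of_pos_right (by positivity)]
          nlinarith [mul_le_mul_of_nonneg_left hdr (by positivity : (0 : ℝ) ≤ 8 * G)]

/-! ## §2 Additive functionals `Σ_i g_i(x_i)`: `48·Σ_i(K_i + G_i)∕(1 + log r⁻¹)` — linear in `d` [folklore] -/

omit [Fintype ι] in
/-- The marginal at coordinate `i` of a law carried by the cube is carried by `[−1,1]`. [bookkeeping] -/
theorem map_eval_Icc_compl {P : Measure (ι → ℝ)} (hP : P (Set.pi Set.univ (fun _ : ι => Set.Icc (-1 : ℝ) 1))ᶜ = 0) (i : ι) :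
    (P.map fun x : ι → ℝ => x i) (Set.Icc (-1 : ℝ) 1)ᶜ = 0 := by
  rw [Measure.map_apply (measurable_pi_apply i) measurableSet_Icc.compl]
  refine measure_mono_null (fun x hx => ?_) hP
  simp only [Set.mem_preimage, Set.mem_compl_iff] at hx ⊢
  exact fun h => hx (Set.mem_univ_pi.1 h i)

omit [Fintype ι] in
/-- Integration against the marginal at coordinate `i`. [bookkeeping] -/
theorem integral_map_eval (P : Measure (ι → ℝ)) (i : ι) {g : ℝ → ℝ} (hg : Continuous g) :
    ∫ y, g y ∂(P.map fun x : ι → ℝ => x i) = ∫ x, g (x i) ∂P :=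
  integral_map (measurable_pi_apply i).aemeasurable hg.aestronglyMeasurable

/-- The mixed monomial with exponent vector `n·e_i` is `x_i^n`. [bookkeeping] -/
theorem prod_pow_single [DecidableEq ι] (x : ι → ℝ) (i : ι) (n : ℕ) : ∏ k, x k ^ (Pi.single i n : ι → ℕ) k = x i ^ n := by
  rw [Fintype.prod_eq_single i fun k hk => by rw [Pi.single_eq_of_ne hk, pow_zero], Pi.single_eq_same]

/-- ★ **ADDITIVE FUNCTIONALS: `48·Σ_i(K_i + G_i)∕(1 + log r⁻¹)`.**  `P, Q` on `[−1,1]^ι` with all mixed moments `r`-close (`0 < r ≤ 1`); `g_i` continuous,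
`K_i`-Lipschitz and `G_i`-bounded on `[−1,1]`.  Then `|∫Σ_i g_i(x_i) dP − ∫Σ_i g_i(x_i) dQ| ≤ 48·Σ_i(K_i+G_i)∕(1 + log r⁻¹)` (the marginals have `r`-close
moments — exponent vectors `n·e_i` — and module 63 prices each coordinate).  LINEAR in the number of strings. [folklore] -/
theorem law_price_additive_le_of_uniformMixedMoments {P Q : Measure (ι → ℝ)} [IsProbabilityMeasure P] [IsProbabilityMeasure Q]
    (hP : P (Set.pi Set.univ (fun _ : ι => Set.Icc (-1 : ℝ) 1))ᶜ = 0) (hQ : Q (Set.pi Set.univ (fun _ : ι => Set.Icc (-1 : ℝ) 1))ᶜ = 0)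
    {r : ℝ} (hr0 : 0 < r) (hr1 : r ≤ 1)
    (hmom : ∀ j : ι → ℕ, |∫ x, ∏ i, x i ^ j i ∂P - ∫ x, ∏ i, x i ^ j i ∂Q| ≤ r)
    {g : ι → ℝ → ℝ} (hg : ∀ i, Continuous (g i)) {K G : ι → ℝ} (hK0 : ∀ i, 0 ≤ K i)
    (hK : ∀ (i : ι) (x y : ℝ), x ∈ Set.Icc (-1 : ℝ) 1 → y ∈ Set.Icc (-1 : ℝ) 1 → |g i x - g i y| ≤ K i * |x - y|)
    (hG : ∀ (i : ι) (x : ℝ), x ∈ Set.Icc (-1 : ℝ) 1 → |g i x| ≤ G i) :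
    |∫ x, ∑ i, g i (x i) ∂P - ∫ x, ∑ i, g i (x i) ∂Q| ≤ 48 * (∑ i, (K i + G i)) / (1 + Real.log r⁻¹) := by
  classical
  have hIP : ∀ i, Integrable (fun x : ι → ℝ => g i (x i)) P := fun i =>
    integrable_of_continuous_of_cube hP ((hg i).comp (continuous_apply i))
  have hIQ : ∀ i, Integrable (fun x : ι → ℝ => g i (x i)) Q := fun i =>
    integrable_of_continuous_of_cube hQ ((hg i).comp (continuous_apply i))
  rw [integral_finsetSum _ (fun i _ => hIP i), integral_finsetSum _ (fun i _ => hIQ i), ← Finset.sum_sub_distrib,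
    Finset.mul_sum, Finset.sum_div]
  refine (abs_sum_le_sum_abs _ _).trans (Finset.sum_le_sum fun i _ => ?_)
  haveI : IsProbabilityMeasure (P.map fun x : ι → ℝ => x i) := Measure.isProbabilityMeasure_map (measurable_pi_apply i).aemeasurable
  haveI : IsProbabilityMeasure (Q.map fun x : ι → ℝ => x i) := Measure.isProbabilityMeasure_map (measurable_pi_apply i).aemeasurable
  have hmom_i : ∀ n : ℕ, |∫ y, y ^ n ∂(P.map fun x : ι → ℝ => x i) - ∫ y, y ^ n ∂(Q.map fun x : ι → ℝ => x i)| ≤ r := fun n => by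
    rw [integral_map_eval P i (continuous_pow n), integral_map_eval Q i (continuous_pow n)]
    have h := hmom (Pi.single i n)
    simp only [prod_pow_single] at h
    exact h
  have h := law_price_le_of_uniformMoments (μ := Q.map fun x : ι → ℝ => x i) (ν := P.map fun x : ι → ℝ => x i)
    (map_eval_Icc_compl hQ i) (map_eval_Icc_compl hP i) hr0 hr1 hmom_i (hg i) (hK0 i) (hK i) (hG i)
  rwa [integral_map_eval P i (hg i), integral_map_eval Q i (hg i)] at h

/-- ★ The same with common constants: `|∫Σ_i g_i(x_i) dP − ∫Σ_i g_i(x_i) dQ| ≤ 48·d·(K+G)∕(1 + log r⁻¹)`. [folklore] -/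
theorem law_price_additive_le_card {P Q : Measure (ι → ℝ)} [IsProbabilityMeasure P] [IsProbabilityMeasure Q]
    (hP : P (Set.pi Set.univ (fun _ : ι => Set.Icc (-1 : ℝ) 1))ᶜ = 0) (hQ : Q (Set.pi Set.univ (fun _ : ι => Set.Icc (-1 : ℝ) 1))ᶜ = 0)
    {r : ℝ} (hr0 : 0 < r) (hr1 : r ≤ 1)
    (hmom : ∀ j : ι → ℕ, |∫ x, ∏ i, x i ^ j i ∂P - ∫ x, ∏ i, x i ^ j i ∂Q| ≤ r)
    {g : ι → ℝ → ℝ} (hg : ∀ i, Continuous (g i)) {K G : ℝ} (hK0 : 0 ≤ K)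
    (hK : ∀ (i : ι) (x y : ℝ), x ∈ Set.Icc (-1 : ℝ) 1 → y ∈ Set.Icc (-1 : ℝ) 1 → |g i x - g i y| ≤ K * |x - y|)
    (hG : ∀ (i : ι) (x : ℝ), x ∈ Set.Icc (-1 : ℝ) 1 → |g i x| ≤ G) :
    |∫ x, ∑ i, g i (x i) ∂P - ∫ x, ∑ i, g i (x i) ∂Q| ≤ 48 * Fintype.card ι * (K + G) / (1 + Real.log r⁻¹) := by
  have h := law_price_additive_le_of_uniformMixedMoments hP hQ hr0 hr1 hmom hg (K := fun _ => K) (G := fun _ => G)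
    (fun _ => hK0) hK hG
  rwa [Finset.sum_const, nsmul_eq_mul, Finset.card_univ, ← mul_assoc] at h

end Summit.QuantumFields.YangMills.Theorems.BalabanUVNodesN19JointLawPriceDimension

end
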